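import Summits.AtomisticToContinuum.FouriersLaw.Theorems.PhononMeanFreePathDefs
import Summits.AtomisticToContinuum.FouriersLaw.Theorems.PhononMeanFreePathCoherentDephasingWeakCouplingCorrelationDecay

/-!
# `CoherentDephasing` / line `Sketch`: coordinate observables of the pinned chain — generator images, sizes, statics

Support file 2/3 for stub `stub_meanFieldDuhamel` of line `Sketch` (coherent-field Beer–Lambert) of crux
`stmt-AtomisticToContinuum-11810` (`PhononMeanFreePath.CoherentDephasing`). Elementary facts about the coordinate
observables `q_x`, `p_x` of the `(N+1)`-site pinned anharmonic chain `P = pinnedChain ω₂ lam β γ` that the Duhamel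
(integrated Dynkin) form of the mean-field equations consumes:

* generator images: `L q_x = p_x` (`generator_fst`), `L p_x = -∂Φ/∂q_x - γ([x=0]+[x=N]) p_x` (`generator_snd`), with the
  force in bond form `∂Φ/∂q_x = ω₂ q_x + lam q_x³ - Σ_b ([b=x] - [b+1=x]) V'(q_{b+1}-q_b)`, `V'(r) = r + β r³`
  (`pinnedChain_dPotential_succ`; bond `b : Fin N` joins sites `b.castSucc`, `b.succ`);
* sizes `|q_x| ≤ C(1+H)`, `|p_x| ≤ 1+H`, `|q_x³|, |p_i p_j|, |V'(q_{b+1}-q_b)| ≤ C(1+H)²`;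
* Gibbs statics: `∫ p_j q_i dμ_T = 0` (momentum reversal) and the registered sub-goal
  `pinnedChain_integral_momentum_zero_mul_momentum`: `∫ p₀ p_x dμ_T = T [x = 0]` (Gibbs second moment on the diagonal,
  Gaussian integration by parts in `p₀` off it).

Nothing here closes an item.
-/

noncomputable section

open MeasureTheory Filter Topology Set

namespace Summit.AtomisticToContinuum.FouriersLaw.Theorems.CoherentDephasing.MeanFieldDuhamel

open Literature.MathematicalPhysics.KineticTheory.HeatConduction
open Literature.MathematicalPhysics.KineticTheory OscillatorChain
open Summit.AtomisticToContinuum.FouriersLaw.Theorems.SubdiffusiveBondHeat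
open Summit.AtomisticToContinuum.FouriersLaw.Theorems.PhononMeanFreePath

/-! ### Coordinate observables: derivatives and generator images -/

section Coordinates

variable {n : ℕ}

/-- `∂_{q_i} q_x = [x = i]`. [folklore] -/
theorem partialQ_fst (i x : Fin n) (z : PhaseSpace n) :
    partialQ i (fun y : PhaseSpace n => y.1 x) z = if x = i then 1 else 0 := by
  unfold partialQ
  by_cases h : x = i
  · subst h; simp
  · simp [h]

/-- `∂_{p_i} q_x = 0`. [folklore] -/
theorem partialP_fst (i x : Fin n) (z : PhaseSpace n) : partialP i (fun y : PhaseSpace n => y.1 x) z = 0 := by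
  simp [partialP]

/-- `∂_{q_i} p_x = 0`. [folklore] -/
theorem partialQ_snd (i x : Fin n) (z : PhaseSpace n) : partialQ i (fun y : PhaseSpace n => y.2 x) z = 0 := by
  simp [partialQ]

/-- `∂_{p_i} p_x = [x = i]`. [folklore] -/
theorem partialP_snd (i x : Fin n) (z : PhaseSpace n) :
    partialP i (fun y : PhaseSpace n => y.2 x) z = if x = i then 1 else 0 := by
  unfold partialP
  by_cases h : x = i
  · subst h; simp
  · simp [h]

/-- `∂²_{p_i} q_x = 0`. [folklore] -/
theorem partialP_partialP_fst (i x : Fin n) (z : PhaseSpace n) :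
    partialP i (partialP i (fun y : PhaseSpace n => y.1 x)) z = 0 := by
  have h : partialP i (fun y : PhaseSpace n => y.1 x) = fun _ => (0:ℝ) := funext fun z => partialP_fst i x z
  rw [h]; simp [partialP]

/-- `∂²_{p_i} p_x = 0`. [folklore] -/
theorem partialP_partialP_snd (i x : Fin n) (z : PhaseSpace n) :
    partialP i (partialP i (fun y : PhaseSpace n => y.2 x)) z = 0 := by
  have h : partialP i (fun y : PhaseSpace n => y.2 x) = fun _ => if x = i then (1:ℝ) else 0 :=
    funext fun z => partialP_snd i x z
  rw [h]; simp [partialP]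

/-- `L q_x = p_x` for every oscillator chain (positions stream with their momenta). [folklore] -/
theorem generator_fst (P : OscillatorChain) (TL TR : ℝ) (x : Fin n) (z : PhaseSpace n) :
    P.generator n TL TR (fun y : PhaseSpace n => y.1 x) z = z.2 x := by
  unfold OscillatorChain.generator
  simp [partialQ_fst, partialP_fst, partialP_partialP_fst]

/-- `L p_x = -∂Φ/∂q_x - γ ([x = 0] + [x = n-1]) p_x` (Newton's law plus the Ornstein–Uhlenbeck friction at the two bath
sites) for differentiable potentials. [folklore] -/
theorem generator_snd (P : OscillatorChain) (hU : Differentiable ℝ P.U) (hV : Differentiable ℝ P.V) (TL TR : ℝ)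
    (x : Fin n) (z : PhaseSpace n) :
    P.generator n TL TR (fun y : PhaseSpace n => y.2 x) z =
      -P.dPotential n x z.1 - P.γ * ((if x.val = 0 then z.2 x else 0) + (if x.val = n - 1 then z.2 x else 0)) := by
  unfold OscillatorChain.generator
  simp only [partialQ_snd, partialP_snd, partialP_partialP_snd, P.partialQ_hamiltonian_eq_dPotential hU hV,
    mul_zero, zero_sub, mul_ite, mul_one]
  rw [Finset.sum_eq_single x (fun i _ hi => by simp [Ne.symm hi]) (fun h => absurd (Finset.mem_univ x) h),
    Finset.sum_eq_single x (fun i _ hi => by simp [Ne.symm hi]) (fun h => absurd (Finset.mem_univ x) h)]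
  simp only [if_true]
  split_ifs <;> ring

/-- A double sum over the bonds `l = k + 1` of the `(N+1)`-site chain is the sum over `b : Fin N` of the bond
`(b.castSucc, b.succ)`. [folklore] -/
theorem sum_sum_ite_succ {N : ℕ} (G : Fin (N + 1) → Fin (N + 1) → ℝ) :
    (∑ k : Fin (N + 1), ∑ l : Fin (N + 1), if l.val = k.val + 1 then G k l else 0) =
      ∑ b : Fin N, G b.castSucc b.succ := by
  rw [Fin.sum_univ_castSucc]
  have hlast : (∑ l : Fin (N + 1), if l.val = (Fin.last N).val + 1 then G (Fin.last N) l else 0) = 0 := by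
    refine Finset.sum_eq_zero fun l _ => ?_
    rw [if_neg]
    have := l.isLt
    simp only [Fin.val_last]
    omega
  rw [hlast, add_zero]
  refine Finset.sum_congr rfl fun b _ => ?_
  rw [Finset.sum_eq_single b.succ]
  · rw [if_pos]; simp [Fin.val_succ]
  · intro l _ hl
    rw [if_neg]
    intro h
    apply hl
    ext
    rw [Fin.val_succ, h, Fin.val_castSucc]
  · intro h; exact absurd (Finset.mem_univ _) h

/-- The force `-∂Φ/∂q_x` of the `(N+1)`-site pinned chain in bond form:
`∂Φ/∂q_x = ω₂ q_x + lam q_x³ - Σ_b ([b = x] - [b+1 = x]) V'(q_{b+1} - q_b)`, `V'(r) = r + β r³`. [folklore] -/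
theorem pinnedChain_dPotential_succ (ω₂ lam β γ : ℝ) (N : ℕ) (x : Fin (N + 1)) (q : Fin (N + 1) → ℝ) :
    (pinnedChain ω₂ lam β γ).dPotential (N + 1) x q =
      ω₂ * q x + lam * q x ^ 3 -
        ∑ b : Fin N, ((if (b : ℕ) = (x : ℕ) then (q b.succ - q b.castSucc) + β * (q b.succ - q b.castSucc) ^ 3 else 0) -
          (if (b : ℕ) + 1 = (x : ℕ) then (q b.succ - q b.castSucc) + β * (q b.succ - q b.castSucc) ^ 3 else 0)) := by
  unfold OscillatorChain.dPotential
  rw [pinnedChain_deriv_U, sum_sum_ite_succ, sub_eq_add_neg, ← Finset.sum_neg_distrib]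
  congr 1
  refine Finset.sum_congr rfl fun b _ => ?_
  rw [pinnedChain_deriv_V]
  have e1 : (b.succ = x) ↔ ((b : ℕ) + 1 = (x : ℕ)) := by rw [Fin.ext_iff, Fin.val_succ]
  have e2 : (b.castSucc = x) ↔ ((b : ℕ) = (x : ℕ)) := by rw [Fin.ext_iff, Fin.val_castSucc]
  by_cases h1 : (b : ℕ) + 1 = (x : ℕ)
  · have h2 : ¬ ((b : ℕ) = (x : ℕ)) := by omega
    simp [h1, h2, e1, e2]
  · by_cases h2 : (b : ℕ) = (x : ℕ)
    · simp [h2, e1, e2]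
    · simp [h1, h2, e1, e2]

end Coordinates

/-! ### Size of the coordinate observables -/

section Bounds

variable {ω₂ lam β : ℝ} (hω : 0 < ω₂) (hl : 0 ≤ lam) (hβ : 0 ≤ β) (γ : ℝ) {n : ℕ}
include hω hl hβ

/-- `|q_x| ≤ (1/2 + 1/ω₂)(1 + H)` (`ω₂ q_x²/2 ≤ H`, `|q| ≤ (1+q²)/2`). [folklore] -/
theorem abs_fst_le (y : PhaseSpace n) (x : Fin n) :
    |y.1 x| ≤ (1 / 2 + 1 / ω₂) * (1 + (pinnedChain ω₂ lam β γ).hamiltonian n y) := by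
  have hU := pinnedChain_U_le_hamiltonian hω.le hl hβ γ n y x
  have hH0 := pinnedChain_hamiltonian_nonneg hω.le hl hβ γ n y
  set H := (pinnedChain ω₂ lam β γ).hamiltonian n y
  have hq4 : 0 ≤ lam * y.1 x ^ 4 / 4 := by positivity
  have hq2 : ω₂ * y.1 x ^ 2 ≤ 2 * H := by linarith
  have h1 := abs_le_half_one_add_sq (y.1 x)
  refine le_of_mul_le_mul_left ?_ hω
  have e : ω₂ * ((1 / 2 + 1 / ω₂) * (1 + H)) = (ω₂ / 2 + 1) * (1 + H) := by field_simp
  rw [e]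
  calc ω₂ * |y.1 x| ≤ ω₂ * ((1 + y.1 x ^ 2) / 2) := mul_le_mul_of_nonneg_left h1 hω.le
    _ = ω₂ / 2 + ω₂ * y.1 x ^ 2 / 2 := by ring
    _ ≤ ω₂ / 2 + H := by linarith
    _ ≤ (ω₂ / 2 + 1) * (1 + H) := by nlinarith [mul_nonneg hω.le hH0]

/-- `|q_x³| ≤ (1/ω₂ + 2/ω₂²)(1 + H)²` (`|q|³ = q² |q|`, `ω₂ q² ≤ 2H`). [folklore] -/
theorem abs_fst_cube_le (y : PhaseSpace n) (x : Fin n) :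
    |y.1 x ^ 3| ≤ (1 / ω₂ + 2 / ω₂ ^ 2) * (1 + (pinnedChain ω₂ lam β γ).hamiltonian n y) ^ 2 := by
  have hU := pinnedChain_U_le_hamiltonian hω.le hl hβ γ n y x
  have hH0 := pinnedChain_hamiltonian_nonneg hω.le hl hβ γ n y
  set H := (pinnedChain ω₂ lam β γ).hamiltonian n y
  have hq4 : 0 ≤ lam * y.1 x ^ 4 / 4 := by positivity
  have hq2 : ω₂ * y.1 x ^ 2 ≤ 2 * H := by linarith
  have h1 := abs_le_half_one_add_sq (y.1 x)
  have hq1 : ω₂ * |y.1 x| ≤ ω₂ / 2 + H := by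
    calc ω₂ * |y.1 x| ≤ ω₂ * ((1 + y.1 x ^ 2) / 2) := mul_le_mul_of_nonneg_left h1 hω.le
      _ = ω₂ / 2 + ω₂ * y.1 x ^ 2 / 2 := by ring
      _ ≤ ω₂ / 2 + H := by linarith
  have hω2 : 0 < ω₂ ^ 2 := by positivity
  refine le_of_mul_le_mul_left ?_ hω2
  have e : ω₂ ^ 2 * ((1 / ω₂ + 2 / ω₂ ^ 2) * (1 + H) ^ 2) = (ω₂ + 2) * (1 + H) ^ 2 := by
    field_simp
  have e3 : |y.1 x| ^ 3 = y.1 x ^ 2 * |y.1 x| := by rw [pow_succ, sq_abs]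
  rw [e, abs_pow, e3]
  calc ω₂ ^ 2 * (y.1 x ^ 2 * |y.1 x|) = (ω₂ * y.1 x ^ 2) * (ω₂ * |y.1 x|) := by ring
    _ ≤ (2 * H) * (ω₂ / 2 + H) := mul_le_mul hq2 hq1 (by positivity) (by positivity)
    _ ≤ (ω₂ + 2) * (1 + H) ^ 2 := by nlinarith [mul_nonneg hω.le hH0, mul_nonneg hω.le (sq_nonneg H), sq_nonneg H]

omit hω in
/-- `|p_x| ≤ 1 + H` (`p_x² ≤ 2H`, `|p| ≤ (1+p²)/2`). [folklore] -/
theorem abs_snd_le (hω' : 0 ≤ ω₂) (y : PhaseSpace n) (x : Fin n) :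
    |y.2 x| ≤ 1 + (pinnedChain ω₂ lam β γ).hamiltonian n y := by
  have hU0 : ∀ q, 0 ≤ (pinnedChain ω₂ lam β γ).U q := fun q => by
    show 0 ≤ ω₂ * q ^ 2 / 2 + lam * q ^ 4 / 4; positivity
  have hV0 : ∀ r, 0 ≤ (pinnedChain ω₂ lam β γ).V r := fun r => by
    show 0 ≤ r ^ 2 / 2 + β * r ^ 4 / 4; positivity
  have h1 := (pinnedChain ω₂ lam β γ).site_le_hamiltonian hU0 hV0 n y x
  have h2 := hU0 (y.1 x)
  have h3 := abs_le_half_one_add_sq (y.2 x)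
  linarith

omit hω in
/-- `|p_i p_j| ≤ 2 (1 + H)²` (`|p_i p_j| ≤ (p_i² + p_j²)/2 ≤ 2H`). [folklore] -/
theorem abs_snd_mul_snd_le (hω' : 0 ≤ ω₂) (y : PhaseSpace n) (i j : Fin n) :
    |y.2 i * y.2 j| ≤ 2 * (1 + (pinnedChain ω₂ lam β γ).hamiltonian n y) ^ 2 := by
  have hU0 : ∀ q, 0 ≤ (pinnedChain ω₂ lam β γ).U q := fun q => by
    show 0 ≤ ω₂ * q ^ 2 / 2 + lam * q ^ 4 / 4; positivity
  have hV0 : ∀ r, 0 ≤ (pinnedChain ω₂ lam β γ).V r := fun r => by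
    show 0 ≤ r ^ 2 / 2 + β * r ^ 4 / 4; positivity
  have hp : ∀ k, y.2 k ^ 2 ≤ 2 * (pinnedChain ω₂ lam β γ).hamiltonian n y := fun k => by
    have h1 := (pinnedChain ω₂ lam β γ).site_le_hamiltonian hU0 hV0 n y k
    have h2 := hU0 (y.1 k)
    linarith
  have hH0 := pinnedChain_hamiltonian_nonneg hω' hl hβ γ n y
  rw [abs_mul]
  nlinarith [sq_abs (y.2 i), sq_abs (y.2 j), sq_nonneg (|y.2 i| - |y.2 j|), hp i, hp j,
    sq_nonneg ((pinnedChain ω₂ lam β γ).hamiltonian n y)]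

omit hω in
/-- The bond force `V'(q_{b+1} - q_b) = r + β r³` (`r` the stretch of bond `b`) is at most `(3 + β)(1 + H)²` in
absolute value (`r²/2 + β r⁴/4 ≤ H`). [folklore] -/
theorem abs_bondForce_le (hω' : 0 ≤ ω₂) {N : ℕ} (y : PhaseSpace (N + 1)) (b : Fin N) :
    |(y.1 b.succ - y.1 b.castSucc) + β * (y.1 b.succ - y.1 b.castSucc) ^ 3| ≤
      (3 + β) * (1 + (pinnedChain ω₂ lam β γ).hamiltonian (N + 1) y) ^ 2 := by
  have hb := pinnedChain_bond_le_hamiltonian hω' hl hβ γ (N + 1) y (i := b.castSucc) (j := b.succ)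
    (by simp [Fin.val_succ])
  have hH0 := pinnedChain_hamiltonian_nonneg hω' hl hβ γ (N + 1) y
  set H := (pinnedChain ω₂ lam β γ).hamiltonian (N + 1) y
  set r := y.1 b.succ - y.1 b.castSucc
  have hr4 : 0 ≤ β * r ^ 4 / 4 := by positivity
  have hr2 : r ^ 2 ≤ 2 * H := by linarith
  have hβr4 : β * r ^ 4 ≤ 4 * H := by nlinarith [sq_nonneg r]
  have h0 := abs_le_half_one_add_sq r
  have h1 : |r| ≤ 1 / 2 + H := by linarith
  have h3 : |β * r ^ 3| ≤ β * H + 2 * H := by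
    rw [abs_mul, abs_of_nonneg hβ, abs_pow, pow_succ, sq_abs]
    have h4 : r ^ 2 * |r| ≤ (r ^ 2 + r ^ 4) / 2 := by
      have e : (r ^ 2 + r ^ 4) / 2 = r ^ 2 * ((1 + r ^ 2) / 2) := by ring
      rw [e]
      exact mul_le_mul_of_nonneg_left h0 (sq_nonneg r)
    calc β * (r ^ 2 * |r|) ≤ β * ((r ^ 2 + r ^ 4) / 2) := mul_le_mul_of_nonneg_left h4 hβ
      _ = (β * r ^ 2 + β * r ^ 4) / 2 := by ring
      _ ≤ (β * (2 * H) + 4 * H) / 2 := by gcongr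
      _ = β * H + 2 * H := by ring
  calc |r + β * r ^ 3| ≤ |r| + |β * r ^ 3| := abs_add_le _ _
    _ ≤ 1 / 2 + H + (β * H + 2 * H) := add_le_add h1 h3
    _ ≤ (3 + β) * (1 + H) ^ 2 := by nlinarith [mul_nonneg hβ hH0, mul_nonneg hβ (sq_nonneg H), sq_nonneg H]

end Bounds

/-! ### Gibbs statics: `∫ p₀ q_x dμ_T = 0`, `∫ p₀ p_x dμ_T = T [x = 0]` -/

section Statics


/-- `∫ p_j q_i dμ_T = 0`: the integrand is odd under the momentum reversal `(q, p) ↦ (q, -p)`, which preserves the Gibbs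
density and Lebesgue measure (no integrability needed). [folklore] -/
theorem integral_momentum_mul_position_gibbsMeasure (ω₂ lam β γ : ℝ) (n : ℕ) (T : ℝ) (j i : Fin n) :
    ∫ z, z.2 j * z.1 i ∂((pinnedChain ω₂ lam β γ).gibbsMeasure n T) = 0 := by
  rw [(pinnedChain ω₂ lam β γ).integral_gibbsMeasure]
  have h := integral_comp_momentumReversal n fun x =>
    x.2 j * x.1 i * (pinnedChain ω₂ lam β γ).gibbsDensity n T x
  simp only [OscillatorChain.gibbsDensity, OscillatorChain.hamiltonian_neg_momentum, Pi.neg_apply,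
    neg_mul, integral_neg] at h
  have h0 : ∫ x, x.2 j * x.1 i * (pinnedChain ω₂ lam β γ).gibbsDensity n T x = 0 := by
    simp only [OscillatorChain.gibbsDensity]
    linarith
  rw [h0, mul_zero]

/-- `∫ p₀ p_x dμ_T = T [x = 0]` for the `(N+1)`-site pinned chain (`ω₂ > 0`, `lam, β ≥ 0`, `T > 0`): on the diagonal
the Gibbs second moment `∫ p₀² dμ_T = T`; off the diagonal, Gaussian integration by parts in `p₀`
(`p₀ e^{-H/T} = -T ∂_{p₀} e^{-H/T}`, `∂_{p₀} p_x = 0`). [folklore] -/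
theorem pinnedChain_integral_momentum_zero_mul_momentum :
    ∀ (ω₂ lam β γ : ℝ), 0 < ω₂ → 0 ≤ lam → 0 ≤ β → ∀ (N : ℕ) (T : ℝ), 0 < T → ∀ (x : Fin (N + 1)),
      ∫ z, z.2 0 * z.2 x ∂((pinnedChain ω₂ lam β γ).gibbsMeasure (N + 1) T) = if (x : ℕ) = 0 then T else 0 := by
  intro ω₂ lam β γ hω hl hβ N T hT x
  by_cases hx : (x : ℕ) = 0
  · have hx' : x = 0 := Fin.ext hx
    rw [if_pos hx, hx']
    have h := pinnedChain_integral_momentum_sq_gibbsMeasure hω hl hβ (N + 1) hT (0 : Fin (N + 1)) (γ := γ)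
    simpa [sq] using h
  rw [if_neg hx, (pinnedChain ω₂ lam β γ).integral_gibbsMeasure]
  have hx' : x ≠ 0 := fun h => hx (by rw [h]; rfl)
  set ρ := (pinnedChain ω₂ lam β γ).gibbsDensity (N + 1) T with hρ
  -- integrability of the products
  have hpx : Integrable fun z : PhaseSpace (N + 1) => z.2 x * ρ z :=
    pinnedChain_integrable_mul_gibbsDensity_of_le hω hl hβ γ (N + 1) hT (by fun_prop) (C := 1) fun z => by
      have h1 := abs_snd_le hl hβ γ hω.le z x
      have h2 := pinnedChain_hamiltonian_nonneg hω.le hl hβ γ (N + 1) z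
      nlinarith
  have hprod : Integrable fun z : PhaseSpace (N + 1) => z.2 x * (-(z.2 0 / T)) * ρ z := by
    refine pinnedChain_integrable_mul_gibbsDensity_of_le hω hl hβ γ (N + 1) hT (by fun_prop) (C := T⁻¹ * 2) fun z => ?_
    have h1 := abs_snd_mul_snd_le hl hβ γ hω.le z x 0
    rw [show z.2 x * (-(z.2 0 / T)) = -T⁻¹ * (z.2 x * z.2 0) by ring, abs_mul, abs_neg, abs_inv, abs_of_pos hT,
      mul_assoc]
    exact mul_le_mul_of_nonneg_left h1 (inv_nonneg.2 hT.le)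
  have hprod' : Integrable fun z : PhaseSpace (N + 1) => z.2 x * (-(z.2 0 / T) * ρ z) :=
    hprod.congr (Eventually.of_forall fun z => mul_assoc _ _ _)
  -- the two line derivatives along `(0, e₀)`
  have hFd : ∀ z : PhaseSpace (N + 1), HasLineDerivAt ℝ (fun z : PhaseSpace (N + 1) => z.2 x) 0 z
      ((0, Pi.single 0 1) : PhaseSpace (N + 1)) := fun z => by
    unfold HasLineDerivAt
    have h : (fun t : ℝ => (fun z : PhaseSpace (N + 1) => z.2 x)
        (z + t • ((0, Pi.single 0 1) : PhaseSpace (N + 1)))) = fun _ => z.2 x := by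
      funext t
      simp [hx']
    rw [h]
    exact hasDerivAt_const _ _
  have hgd : ∀ z, HasLineDerivAt ℝ ρ (-(z.2 0 / T) * ρ z) z ((0, Pi.single 0 1) : PhaseSpace (N + 1)) := fun z =>
    (pinnedChain ω₂ lam β γ).hasLineDerivAt_gibbsDensity
      ((pinnedChain ω₂ lam β γ).hasLineDerivAt_hamiltonian_unitP (N + 1) z 0)
  have e := integral_mul_eq_neg_of_hasLineDerivAt_of_integrable (F := fun z : PhaseSpace (N + 1) => z.2 x)
    (F' := fun _ => (0:ℝ)) (g := ρ) (g' := fun z => -(z.2 0 / T) * ρ z)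
    (v := ((0, Pi.single 0 1) : PhaseSpace (N + 1))) (by simp) hprod' hpx hFd hgd
  simp only [zero_mul, integral_zero, neg_zero] at e
  have e2 : ∫ z : PhaseSpace (N + 1), z.2 x * (-(z.2 0 / T) * ρ z) =
      (-T⁻¹) * ∫ z : PhaseSpace (N + 1), z.2 0 * z.2 x * ρ z := by
    rw [← integral_const_mul]
    refine integral_congr_ae (Eventually.of_forall fun z => ?_)
    ring
  rw [e2] at e
  have hT' : (-T⁻¹ : ℝ) ≠ 0 := by simp [hT.ne']
  rw [(mul_eq_zero.1 e).resolve_left hT', mul_zero]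

end Statics
end Summit.AtomisticToContinuum.FouriersLaw.Theorems.CoherentDephasing.MeanFieldDuhamel

end
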